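import Literature.Probability.LatticeModels.DomainDiscretisation
import Literature.Topology.PlaneTopology.CrosscutProofs
import HarnessLib

/-!
# A cross-cut of a Jordan domain separates the walks of `Ω_δ` (Newman separation of lattice walks)

Sub-problem `CriticalPhenomena/SAWScalingLimit`, crux `AvoidanceLimit`
(`Summit.CriticalPhenomena.SAWScalingLimit.Theses.SAWLoopFugacityFlow.AvoidanceLimit`,
stmt-CriticalPhenomena-10649), line `symplectic-fermion-anchor`, stub W3
(`exists_mem_support_of_crosscut`).

In the hub factorisation of the exit kernel of the edge-killed walk, a *wall* — a cross-cut `L`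
of the Jordan domain `D` from `D.boundary σ₁` to `D.boundary σ₂` (`σ₁ < σ₂ < σ₁ + 1`), assembled
from lattice pieces — has to separate, in the graph `Ω^δ = discreteDomainGraph D.carrier δ`, the
inner starting sites `u` from the outer exits `x`: every walk of `Ω^δ` from `u` to `x` visits the
wall site set `W`. The hypotheses are (i) grid geometry: every edge of `Ω^δ` whose closed segment
meets `L` has an end in `W`; (ii) side certificates: `δu` (resp. `δx`) is joined inside `D̄`,
avoiding `L`, to a point of the open boundary arc `D.boundary '' (σ₁, σ₂)`
(resp. `D.boundary '' (σ₂, σ₁ + 1)`) by a preconnected set `S₁` (resp. `S₂`).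

Proof. Newman's cross-cut theorem (Newman 1939, Ch. V §11, Thms. 11·7–11·8;
`Literature.Topology.PlaneTopology.Newman1939_crosscut_holds`) splits `D ∖ L = U₁ ∪ U₂` into two
disjoint domains with `∂U₁ = L ∪ D.boundary '' [σ₁, σ₂]`, `∂U₂ = L ∪ D.boundary '' [σ₂, σ₁ + 1]`;
hence `D̄ ⊆ Ū₁ ∪ Ū₂` and `Ū₁ ∩ Ū₂ ⊆ L` (`exists_closed_sides_of_crosscut`, the argument of
`JordanDomain.inter_nonempty_of_crosscut` in `Literature/Topology/PlaneTopology/Crosscut.lean`).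
A preconnected subset of `D̄` avoiding `L` cannot meet both closed sides
(`false_of_preconnected_meets_both_sides`); so `δu ∉ Ū₂` (via `S₁`) and `δx ∈ Ū₂` (via `S₂`).
Finally, by induction along the walk (`exists_mem_support_of_not_mem_side`): an edge whose
segment misses `L` is a preconnected subset of `D̄ ∖ L` starting off `Ū₂`, so it ends off `Ū₂`;
since the walk ends at `δx ∈ Ū₂`, some edge segment meets `L`, and (i) puts one of its ends in
`W`. The mesh hypothesis `0 < δ` of the registered statement is not used.

## References
* M. H. A. Newman, *Elements of the topology of plane sets of points*, Cambridge Univ. Press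
  (1939), Ch. V §11, Thms. 11·7–11·8. [Newman1939]
-/

noncomputable section

open Set Metric
open Literature.Topology.PlaneTopology
open Literature.Probability.LatticeModels
open Literature.Probability.RandomPlanarGeometry (JordanDomain)

namespace Summit.CriticalPhenomena.SAWScalingLimit.Theorems.AvoidanceLimit.Anchor

/-- **The two closed sides of a cross-cut.** If `L` is a cross-cut of the Jordan domain `D` from
`boundary s` to `boundary t` (`s < t < s + 1`), there are closed sets `C₁`, `C₂` (the closures of
the two components of `D ∖ L`) covering `D̄` and meeting only inside `L`, with
`boundary '' [s, t] ⊆ C₁` and `boundary '' [t, s + 1] ⊆ C₂` (Newman 1939, Ch. V §11,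
Thms. 11·7–11·8; the argument of `JordanDomain.inter_nonempty_of_crosscut`).
[cite: Newman1939, Ch. V §11, Thms. 11·7–11·8] -/
theorem exists_closed_sides_of_crosscut (D : JordanDomain) {L : Set ℂ} {s t : ℝ} (hst : s < t)
    (hts : t < s + 1) (hL : D.IsCrosscut L (D.boundary s) (D.boundary t)) :
    ∃ C₁ C₂ : Set ℂ, IsClosed C₁ ∧ IsClosed C₂ ∧ closure D.carrier ⊆ C₁ ∪ C₂ ∧ C₁ ∩ C₂ ⊆ L ∧
      D.boundary '' Icc s t ⊆ C₁ ∧ D.boundary '' Icc t (s + 1) ⊆ C₂ := by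
  obtain ⟨U₁, U₂, hU₁o, hU₂o, -, -, hdisj, hunion, hf₁, hf₂⟩ :=
    Newman1939_crosscut_holds D L s t hst hts hL
  have haL : D.boundary s ∈ L := hL.1.left_mem
  have hbL : D.boundary t ∈ L := hL.1.right_mem
  have hA₁ : D.boundary '' Icc s t ⊆ closure U₁ := by
    rw [closure_eq_self_union_frontier, hf₁]
    exact fun z hz => Or.inr (Or.inr hz)
  have hA₂ : D.boundary '' Icc t (s + 1) ⊆ closure U₂ := by
    rw [closure_eq_self_union_frontier, hf₂]
    exact fun z hz => Or.inr (Or.inr hz)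
  refine ⟨closure U₁, closure U₂, isClosed_closure, isClosed_closure, ?_, ?_, hA₁, hA₂⟩
  · -- the closures of `U₁`, `U₂` cover `D̄ = D ∪ ∂D`, `∂D` being the union of the two arcs
    intro z hz
    rw [closure_eq_self_union_frontier] at hz
    rcases hz with hz | hz
    · by_cases hzL : z ∈ L
      · exact Or.inl (by rw [closure_eq_self_union_frontier, hf₁]; exact Or.inr (Or.inl hzL))
      · have : z ∈ U₁ ∪ U₂ := by rw [hunion]; exact ⟨hz, hzL⟩
        exact this.imp (fun h => subset_closure h) (fun h => subset_closure h)
    · rw [D.frontier_eq_union_image_boundary s t] at hz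
      exact hz.imp (fun h => hA₁ h) (fun h => hA₂ h)
  · -- a common point lies in neither open set, hence on both arcs, hence at an end of `L`
    intro z ⟨hz₁, hz₂⟩
    by_contra hzL
    have hzU₁ : z ∉ U₁ := fun hz => Set.disjoint_left.1 (hdisj.closure_right hU₁o) hz hz₂
    have hzU₂ : z ∉ U₂ := fun hz => Set.disjoint_left.1 (hdisj.symm.closure_right hU₂o) hz hz₁
    rw [closure_eq_self_union_frontier, hf₁] at hz₁
    rw [closure_eq_self_union_frontier, hf₂] at hz₂
    have hz₁' : z ∈ D.boundary '' Icc s t := by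
      rcases hz₁ with h | h | h
      · exact absurd h hzU₁
      · exact absurd h hzL
      · exact h
    have hz₂' : z ∈ D.boundary '' Icc t (s + 1) := by
      rcases hz₂ with h | h | h
      · exact absurd h hzU₂
      · exact absurd h hzL
      · exact h
    rcases D.image_boundary_inter_subset hst hts ⟨hz₁', hz₂'⟩ with rfl | rfl
    · exact hzL haL
    · exact hzL hbL

/-- A preconnected set covered by two closed sets `C₁`, `C₂` whose intersection lies in `L`, and
avoiding `L`, cannot meet both `C₁` and `C₂`. [folklore] -/
theorem false_of_preconnected_meets_both_sides {C₁ C₂ L S : Set ℂ} (hC₁ : IsClosed C₁)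
    (hC₂ : IsClosed C₂) (hCL : C₁ ∩ C₂ ⊆ L) (hS : IsPreconnected S) (hSC : S ⊆ C₁ ∪ C₂)
    (hSL : Disjoint S L) (h₁ : (S ∩ C₁).Nonempty) (h₂ : (S ∩ C₂).Nonempty) : False := by
  obtain ⟨z, hzS, hz⟩ := isPreconnected_closed_iff.1 hS C₁ C₂ hC₁ hC₂ hSC h₁ h₂
  exact Set.disjoint_left.1 hSL hzS (hCL hz)

/-- **Walk induction.** In a graph on the sites of `δℤ²` whose closed mesh edges lie in a set `E`
covered by two closed sets `C₁`, `C₂` meeting only inside `L`, if every edge whose segment meets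
`L` has an end in `W`, then every walk from a site whose mesh point is off `C₂` to a site whose
mesh point is in `C₂` visits `W`: a mesh edge missing `L` is preconnected, so it cannot pass from
off `C₂` into `C₂`. [folklore] -/
theorem exists_mem_support_of_not_mem_side {G : SimpleGraph (Site 2)} {δ : ℝ}
    {E C₁ C₂ L : Set ℂ} {W : Set (Site 2)} (hC₁ : IsClosed C₁) (hC₂ : IsClosed C₂)
    (hE : E ⊆ C₁ ∪ C₂) (hCL : C₁ ∩ C₂ ⊆ L)
    (hseg : ∀ a c : Site 2, G.Adj a c → segment ℝ (meshPoint δ a) (meshPoint δ c) ⊆ E)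
    (hW : ∀ a c : Site 2, G.Adj a c →
      (segment ℝ (meshPoint δ a) (meshPoint δ c) ∩ L).Nonempty → a ∈ W ∨ c ∈ W)
    {a x : Site 2} (p : G.Walk a x) (ha : meshPoint δ a ∉ C₂) (hx : meshPoint δ x ∈ C₂) :
    ∃ w ∈ p.support, w ∈ W := by
  induction p with
  | nil => exact absurd hx ha
  | @cons a b y hab q ih =>
    by_cases hL : (segment ℝ (meshPoint δ a) (meshPoint δ b) ∩ L).Nonempty
    · -- the first edge meets `L`: one of its ends is in `W`
      rcases hW a b hab hL with h | h
      · exact ⟨a, by simp, h⟩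
      · exact ⟨b, by simp, h⟩
    · -- the first edge misses `L`: it stays off `C₂`, induct
      have hb : meshPoint δ b ∉ C₂ := by
        intro hb
        have hLd : Disjoint (segment ℝ (meshPoint δ a) (meshPoint δ b)) L :=
          Set.disjoint_iff_inter_eq_empty.2 (Set.not_nonempty_iff_eq_empty.1 hL)
        have hsE : segment ℝ (meshPoint δ a) (meshPoint δ b) ⊆ E := hseg a b hab
        have ha₁ : meshPoint δ a ∈ C₁ := (hE (hsE (left_mem_segment ℝ _ _))).resolve_right ha
        exact false_of_preconnected_meets_both_sides hC₁ hC₂ hCL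
          (convex_segment _ _).isPreconnected (hsE.trans hE) hLd
          ⟨_, left_mem_segment ℝ _ _, ha₁⟩ ⟨_, right_mem_segment ℝ _ _, hb⟩
      obtain ⟨w, hw, hwW⟩ := ih hb hx
      exact ⟨w, by simp [hw], hwW⟩

/-- **A cross-cut separates the walks of `Ω_δ`** (Newman separation of lattice walks). Let `L` be
a cross-cut of the Jordan domain `D` from `D.boundary σ₁` to `D.boundary σ₂` (`σ₁ < σ₂ < σ₁ + 1`)
and `W` a set of sites containing an end of every edge of `Ω^δ = discreteDomainGraph D.carrier δ`
whose closed segment meets `L`. If `δu` is joined to a point of the open arc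
`D.boundary '' (σ₁, σ₂)`, and `δx` to a point of `D.boundary '' (σ₂, σ₁ + 1)`, by preconnected
subsets of `D̄` avoiding `L`, then every walk of `Ω^δ` from `u` to `x` has a vertex in `W`.
(Consequence of Newman 1939, Ch. V §11, Thms. 11·7–11·8: the closures of the two components of
`D ∖ L` cover `D̄` and meet inside `L`.) [cite: Newman1939, Ch. V §11, Thms. 11·7–11·8] -/
theorem exists_mem_support_of_crosscut :
    ∀ (D : JordanDomain) (δ : ℝ), 0 < δ →
    ∀ (L : Set ℂ) (σ₁ σ₂ : ℝ), σ₁ < σ₂ → σ₂ < σ₁ + 1 → D.IsCrosscut L (D.boundary σ₁) (D.boundary σ₂) →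
    ∀ (W : Set (Site 2)),
      (∀ a c : Site 2, (discreteDomainGraph D.carrier δ).Adj a c →
        (segment ℝ (meshPoint δ a) (meshPoint δ c) ∩ L).Nonempty → a ∈ W ∨ c ∈ W) →
    ∀ (u x : Site 2) (p : (discreteDomainGraph D.carrier δ).Walk u x) (S₁ S₂ : Set ℂ),
      IsPreconnected S₁ → S₁ ⊆ closure D.carrier → Disjoint S₁ L → meshPoint δ u ∈ S₁ →
      (∃ θ ∈ Set.Ioo σ₁ σ₂, D.boundary θ ∈ S₁) →
      IsPreconnected S₂ → S₂ ⊆ closure D.carrier → Disjoint S₂ L → meshPoint δ x ∈ S₂ →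
      (∃ θ ∈ Set.Ioo σ₂ (σ₁ + 1), D.boundary θ ∈ S₂) →
      ∃ w ∈ p.support, w ∈ W := by
  intro D δ _ L σ₁ σ₂ h₁ h₂ hL W hW u x p S₁ S₂ hS₁ hS₁D hS₁L hu hθ₁ hS₂ hS₂D hS₂L hx hθ₂
  obtain ⟨θ₁, hθ₁, hθ₁S⟩ := hθ₁
  obtain ⟨θ₂, hθ₂, hθ₂S⟩ := hθ₂
  obtain ⟨C₁, C₂, hC₁, hC₂, hcov, hCL, hA₁, hA₂⟩ := exists_closed_sides_of_crosscut D h₁ h₂ hL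
  -- `δu` is off the far side `C₂`: `S₁` joins it to the near arc, avoiding `L`
  have hu₂ : meshPoint δ u ∉ C₂ := fun hu₂ =>
    false_of_preconnected_meets_both_sides hC₁ hC₂ hCL hS₁ (hS₁D.trans hcov) hS₁L
      ⟨_, hθ₁S, hA₁ ⟨θ₁, Ioo_subset_Icc_self hθ₁, rfl⟩⟩ ⟨_, hu, hu₂⟩
  -- `δx` is on the far side `C₂`: `S₂` joins it to the far arc, avoiding `L`
  have hx₂ : meshPoint δ x ∈ C₂ := by
    by_contra hx₂
    exact false_of_preconnected_meets_both_sides hC₁ hC₂ hCL hS₂ (hS₂D.trans hcov) hS₂L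
      ⟨_, hx, (hcov (hS₂D hx)).resolve_right hx₂⟩
      ⟨_, hθ₂S, hA₂ ⟨θ₂, Ioo_subset_Icc_self hθ₂, rfl⟩⟩
  exact exists_mem_support_of_not_mem_side hC₁ hC₂ hcov hCL
    (fun a c hac => (meshGraph_adj_iff.1 (discreteDomainGraph_adj_iff.1 hac).1).2) hW p hu₂ hx₂

end Summit.CriticalPhenomena.SAWScalingLimit.Theorems.AvoidanceLimit.Anchor

end
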